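import Literature.NumberTheory.LFunctions.HardyZExtremaCriterion
import Literature.NumberTheory.LFunctions.RiemannSiegelPhase
import Literature.NumberTheory.LFunctions.RiemannXiHadamardProduct
import Literature.NumberTheory.LFunctions.RiemannXiLogDeriv
import Literature.NumberTheory.LFunctions.SelbergFujiiLargeGaps
import Literature.NumberTheory.LFunctions.ZetaZeroBoxEnumeration
import HarnessLib

/-!
# Ivić 2003, Proposition 1 — PROVED: under RH, `Z'/Z` decreases between consecutive zeros of `Z`

Topic `Literature/NumberTheory/LFunctions` (namespace `Literature.NumberTheory.LFunctions`; the steps of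
the proof in the grouping sub-namespace `Ivic2003`). PROOF-ONLY module (D-0014/D-0026): theorems, no
definitions, no named facts. It discharges the named fact
`Literature.NumberTheory.LFunctions.Ivic2003_prop1` of `HardyZExtremaCriterion.lean`:

> **Proposition 1** (A. Ivić, *On some reasons for doubting the Riemann hypothesis*, §2;
> arXiv:math/0311162, reprinted in Borwein–Choi–Rooney–Weirathmueller (eds.), *The Riemann
> Hypothesis*, CMS Books, Springer 2008, pp. 112–113). *If the RH is true, then the graph of
> `Z'(t)/Z(t)` is monotonically decreasing between the zeros of `Z(t)` for `t ≥ t₀`.*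

as typed: `RiemannHypothesis → ∃ t₀, ∀ a b, t₀ ≤ a → (∀ t ∈ (a,b), Z(t) ≠ 0) →
StrictAntiOn (Z'/Z) (a,b)` — `Ivic2003_prop1_holds`. LABEL: an RH-CONSEQUENCE from the literature
(an implication with `RiemannHypothesis` as hypothesis); nothing here bears on the truth of RH.

## The printed proof (arXiv:math/0311162, §2, pp. 3–4) and how it is formalised

Ivić: with `ξ(s) = ½s(s−1)π^{−s/2}Γ(s/2)ζ(s)` one has unconditionally
(2.1) `ξ'/ξ(s) = B + Σ_ρ (1/(s−ρ) + 1/ρ)`; `ξ(½+it) = −f(t)Z(t)` with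
`f(t) = ½π^{−1/4}(t²+¼)|Γ(¼+it/2)|`, so (2.2) `Z'/Z(t) = −f'/f(t) + i ξ'/ξ(½+it)`; under RH,
`(i ξ'/ξ(½+it))' = −Σ_γ (t−γ)^{−2} < −C(log log t)²` by (1.12) (Littlewood's gap bound), while
`(f'/f)' ≪ 1/t` by Stirling, whence `(Z'/Z)' < 0` for `t ≥ t₀`.

The same architecture, on the tree's objects:

* §1 `Ivic2003.deriv_hardyZ_div_eq` — `Z'/Z(t) = −Im ζ'/ζ(½+it)` (logarithmic differentiation of
  the tree's `Z(t) = Re (e^{iθ(t)} ζ(½+it))`, `ofReal_hardyZ_holds`, `hasDerivAt_riemannSiegelTheta_holds`;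
  also `Ivic2003.hasDerivAt_hardyZ`);
* §2 `Ivic2003.neg_im_logDeriv_zeta_critPt` — (2.2): `−Im ζ'/ζ(½+it) = −Im ξ'/ξ(½+it) − 2t/(t²+¼)
  + ½ Im ψ(¼+it/2)` (`logDeriv_riemannXi_eq`, `logDeriv_Gammaℝ`, `logDeriv_riemannZeta_eq`); the
  last two terms are `−f'/f`;
* §3 `Ivic2003.hasSum_neg_im_logDeriv_riemannXi` — (2.1) on the line under RH:
  `−Im ξ'/ξ(½+it) = Σₙ [1/(t−γₙ) + 1/(t+γₙ)]`, the tree's grouped Hadamard series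
  `IsHadamardSeq.logDeriv_riemannXi_eq_tsum_pairs` (`RiemannXiHadamardProduct.lean`: `ξ'/ξ(s) =
  Σₙ [1/(s−ρₙ) + 1/(s−(1−ρₙ))]`, the constant `B` absorbed by the pairing) with `Re ρₙ = ½` (RH);
  `Ivic2003.exists_index_of_riemannXi_eq_zero`: every zero of `ξ` is a `ρₙ` or `1 − ρₙ`;
* DEVIATION 1 (§4, §7 `Ivic2003.tsum_decrement`): instead of differentiating the series termwise we
  compare DIFFERENCES: on a zero-free `(a,b)` no `±γₙ` lies in `[t₁,t₂]` (they are zeros of `Z`),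
  so every term `1/(t−γₙ)+1/(t+γₙ)` decreases from `t₁` to `t₂`, and the term of one zero `γ` with
  `t₁ < γ ≤ t₁ + C₀` alone decreases by `≥ (t₂−t₁)/C₀²`;
* DEVIATION 2 (§5 `Ivic2003.exists_critical_zero_window`): instead of Littlewood's (1.12) we use a
  bounded window — `N(t) < N(t+C₀)` for `t ≥ T₀` (the tree's `SelbergFujii.exists_zetaZeroCount_lt_add`,
  Riemann–von Mangoldt) and RH put a zero of `Z` in every `(t, t+C₀]`; this suffices because the
  smooth part is `o(1)`-Lipschitz, and it makes `t₀` depend only on `C₀, T₀` (ineffective here, as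
  typed; Ivić remarks `t₀ ≤ 1000`);
* DEVIATION 3 (§6 `Ivic2003.im_digamma_sub_le`, `Ivic2003.corr_sub_le`): instead of Stirling,
  the exact series `Im ψ(w) = Σₖ Im w/‖w+k‖²` (`hasSum_im_digamma`) and the tree's
  `tsum_inv_norm_add_sq_le` give `c(t₂) − c(t₁) ≤ 4(t₂−t₁)/t₁` for the smooth part
  `c(t) = −2t/(t²+¼) + ½ Im ψ(¼+it/2)`, `1 ≤ t₁ ≤ t₂`;
* §7 `Ivic2003_prop1_holds` with `t₀ = max(T₀, 1, 4C₀² + 1)`.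

## References

* [Ivic2003] A. Ivić, *On some reasons for doubting the Riemann hypothesis*, arXiv:math/0311162
  (2003), §2, Proposition 1 and its proof ((2.1), (2.2)); reprinted in P. Borwein, S. Choi,
  B. Rooney, A. Weirathmueller (eds.), *The Riemann Hypothesis*, Springer 2008, pp. 112–113
  (held: `paper:arxiv-math_0311162`, p0003 L63–L140, p0004 L1–L8).
* [Polymath2019] D. H. J. Polymath, Res. Math. Sci. 6 (2019), §3 (grouped Hadamard product; tree
  `RiemannXiHadamardProduct.lean`).
* [Titchmarsh1986] E. C. Titchmarsh, *The Theory of the Riemann Zeta-Function*, §4.17 (`Z`, `θ`),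
  Thm. 9.4 (Riemann–von Mangoldt).
-/

noncomputable section

open Complex Filter Set
open scoped Real Topology ComplexConjugate

namespace Literature.NumberTheory.LFunctions

namespace Ivic2003

/-! ## §1. `Z'/Z(t) = −Im ζ'/ζ(½ + it)` -/

/-- The point `s(t) = ½ + it` on the critical line. [folklore] -/
private theorem hasDerivAt_critPt (t : ℝ) :
    HasDerivAt (fun u : ℝ ↦ (1 / 2 : ℂ) + (u : ℂ) * I) I t := by
  have h : HasDerivAt (fun u : ℝ ↦ (u : ℂ) * I) ((1 : ℝ) * I) t :=
    ((hasDerivAt_id t).ofReal_comp).mul_const I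
  simpa using h.const_add (1 / 2 : ℂ)

/-- `½ + it ≠ 1`. [folklore] -/
private theorem critPt_ne_one (t : ℝ) : (1 / 2 : ℂ) + (t : ℂ) * I ≠ 1 := by
  intro h
  have := congrArg Complex.re h
  norm_num at this

/-- The derivative of `t ↦ ζ(½ + it)`. [folklore] -/
private theorem hasDerivAt_zeta_critPt (t : ℝ) :
    HasDerivAt (fun u : ℝ ↦ riemannZeta (1 / 2 + (u : ℂ) * I))
      (deriv riemannZeta (1 / 2 + (t : ℂ) * I) * I) t :=
  ((differentiableAt_riemannZeta (critPt_ne_one t)).hasDerivAt).comp t (hasDerivAt_critPt t)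

/-- The complex form `F(t) = e^{iθ(t)} ζ(½ + it)` of `Z` and its derivative
`F'(t) = e^{iθ} (iθ' ζ + i ζ')`. [cite: Ivic2003, §2 (2.2)] -/
private theorem hasDerivAt_F (t : ℝ) :
    HasDerivAt (fun u : ℝ ↦ cexp (riemannSiegelTheta u * I) * riemannZeta (1 / 2 + (u : ℂ) * I))
      (cexp (riemannSiegelTheta t * I) * ((riemannSiegelThetaDeriv t : ℂ) * I) *
          riemannZeta (1 / 2 + (t : ℂ) * I) +
        cexp (riemannSiegelTheta t * I) * (deriv riemannZeta (1 / 2 + (t : ℂ) * I) * I)) t := by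
  have h1 : HasDerivAt (fun u : ℝ ↦ (riemannSiegelTheta u : ℂ) * I)
      ((riemannSiegelThetaDeriv t : ℂ) * I) t :=
    ((hasDerivAt_riemannSiegelTheta_holds t).ofReal_comp).mul_const I
  exact (h1.cexp).mul (hasDerivAt_zeta_critPt t)

/-- **`Z` is differentiable**, with `Z'(t) = Re F'(t)`, `F(t) = e^{iθ(t)} ζ(½ + it)` (the `Z'`
of Ivić's (2.2); Titchmarsh §4.17). [cite: Ivic2003, §2 (2.2)] -/
theorem hasDerivAt_hardyZ (t : ℝ) :
    HasDerivAt hardyZ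
      (cexp (riemannSiegelTheta t * I) * ((riemannSiegelThetaDeriv t : ℂ) * I) *
          riemannZeta (1 / 2 + (t : ℂ) * I) +
        cexp (riemannSiegelTheta t * I) * (deriv riemannZeta (1 / 2 + (t : ℂ) * I) * I)).re t := by
  have h := (Complex.reCLM.hasFDerivAt.comp_hasDerivAt t (hasDerivAt_F t))
  have h2 : HasDerivAt
      (fun u : ℝ ↦ (cexp (riemannSiegelTheta u * I) * riemannZeta (1 / 2 + (u : ℂ) * I)).re)
      (cexp (riemannSiegelTheta t * I) * ((riemannSiegelThetaDeriv t : ℂ) * I) *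
          riemannZeta (1 / 2 + (t : ℂ) * I) +
        cexp (riemannSiegelTheta t * I) * (deriv riemannZeta (1 / 2 + (t : ℂ) * I) * I)).re t := by
    simpa only [Function.comp_def, Complex.reCLM_apply] using h
  have e : hardyZ = fun u : ℝ ↦
      (cexp (riemannSiegelTheta u * I) * riemannZeta (1 / 2 + (u : ℂ) * I)).re := rfl
  rw [e]
  exact h2

/-- **Ivić (2.2) in `ζ`-form: `Z'(t)/Z(t) = −Im ζ'/ζ(½ + it)`** at every `t` with
`ζ(½ + it) ≠ 0` (logarithmic differentiation of `Z(t) = e^{iθ(t)} ζ(½ + it)`, `θ` real).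
[cite: Ivic2003, §2 (2.2)] -/
theorem deriv_hardyZ_div_eq {t : ℝ} (hζ : riemannZeta (1 / 2 + (t : ℂ) * I) ≠ 0) :
    deriv hardyZ t / hardyZ t =
      -(deriv riemannZeta (1 / 2 + (t : ℂ) * I) / riemannZeta (1 / 2 + (t : ℂ) * I)).im := by
  set s : ℂ := 1 / 2 + (t : ℂ) * I with hs
  set E : ℂ := cexp (riemannSiegelTheta t * I) with hE
  have hZ : (hardyZ t : ℂ) = E * riemannZeta s := ofReal_hardyZ_holds t
  have hZne : hardyZ t ≠ 0 := fun h0 ↦ hζ ((hardyZ_eq_zero_iff_holds t).1 h0)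
  rw [(hasDerivAt_hardyZ t).deriv]
  -- `F' = Z · i · (θ' + ζ'/ζ)`
  have hF' : E * ((riemannSiegelThetaDeriv t : ℂ) * I) * riemannZeta s +
      E * (deriv riemannZeta s * I) =
      (hardyZ t : ℂ) * (I * ((riemannSiegelThetaDeriv t : ℂ) + deriv riemannZeta s / riemannZeta s)) := by
    rw [hZ]
    field_simp
  rw [hF']
  rw [Complex.re_ofReal_mul]
  have him : (I * ((riemannSiegelThetaDeriv t : ℂ) + deriv riemannZeta s / riemannZeta s)).re =
      -(deriv riemannZeta s / riemannZeta s).im := by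
    simp [Complex.mul_re, Complex.add_im]
  rw [him, mul_div_right_comm, div_self hZne, one_mul]

/-! ## §2. `−Im ζ'/ζ(½+it) = −Im ξ'/ξ(½+it) − 2t/(t²+¼) + ½ Im ψ(¼ + it/2)` -/

/-- `Im (1/(½ + it)) = −t/(t² + ¼)`. [folklore] -/
private theorem im_one_div_critPt (t : ℝ) :
    (1 / ((1 / 2 : ℂ) + (t : ℂ) * I)).im = -t / (t ^ 2 + 1 / 4) := by
  rw [one_div, Complex.inv_im]
  have hn : Complex.normSq ((1 / 2 : ℂ) + (t : ℂ) * I) = t ^ 2 + 1 / 4 := by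
    rw [Complex.normSq_apply]; simp; ring
  rw [hn]; simp

/-- `Im (1/(½ + it − 1)) = −t/(t² + ¼)`. [folklore] -/
private theorem im_inv_critPt_sub_one (t : ℝ) :
    (((1 / 2 : ℂ) + (t : ℂ) * I - 1)⁻¹).im = -t / (t ^ 2 + 1 / 4) := by
  rw [Complex.inv_im]
  have hn : Complex.normSq ((1 / 2 : ℂ) + (t : ℂ) * I - 1) = t ^ 2 + 1 / 4 := by
    rw [Complex.normSq_apply]; simp; ring
  rw [hn]; simp

/-- `(½ + it)/2 = ¼ + i t/2` is not a pole of `ψ`. [folklore] -/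
private theorem critPt_div_two_ne_neg_nat (t : ℝ) (m : ℕ) :
    ((1 / 2 : ℂ) + (t : ℂ) * I) / 2 ≠ -(m : ℂ) := by
  intro h
  have := congrArg Complex.re h
  simp at this
  linarith [m.cast_nonneg (α := ℝ)]

/-- `(½ + it)/2 = ¼ + (t/2) i`. [folklore] -/
private theorem critPt_div_two (t : ℝ) :
    ((1 / 2 : ℂ) + (t : ℂ) * I) / 2 = (1 / 4 : ℂ) + ((t / 2 : ℝ) : ℂ) * I := by
  push_cast; ring

/-- **Ivić (2.2) in `ξ`-form.** At `s = ½ + it` with `ζ(s) ≠ 0`: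
`−Im ζ'/ζ(s) = −Im ξ'/ξ(s) − 2t/(t² + ¼) + ½ Im ψ(¼ + it/2)`, from
`ξ'/ξ = 1/s + 1/(s−1) − ½ log π + ½ ψ(s/2) + ζ'/ζ` (the tree's `logDeriv_riemannXi_eq`,
`logDeriv_Gammaℝ`, `logDeriv_riemannZeta_eq`) and `Im 1/s = Im 1/(s−1) = −t/(t²+¼)`. This is
Ivić's `Z'/Z = −f'/f + i ξ'/ξ(½+it)` with `f(t) = ½π^{−1/4}(t²+¼)|Γ(¼+it/2)|`.
[cite: Ivic2003, §2 (2.1)–(2.2)] -/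
theorem neg_im_logDeriv_zeta_critPt {t : ℝ} (hζ : riemannZeta (1 / 2 + (t : ℂ) * I) ≠ 0) :
    -(deriv riemannZeta (1 / 2 + (t : ℂ) * I) / riemannZeta (1 / 2 + (t : ℂ) * I)).im =
      -(logDeriv riemannXi (1 / 2 + (t : ℂ) * I)).im - 2 * t / (t ^ 2 + 1 / 4) +
        (Complex.digamma ((1 / 4 : ℂ) + ((t / 2 : ℝ) : ℂ) * I)).im / 2 := by
  set s : ℂ := 1 / 2 + (t : ℂ) * I with hs
  have hs1 : s ≠ 1 := critPt_ne_one t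
  have hre : 0 < s.re := by simp [hs]
  have hζ₁ : riemannZeta₁ s ≠ 0 := by
    rw [riemannZeta₁_eq_mul hs1]
    exact mul_ne_zero (sub_ne_zero.2 hs1) hζ
  have hξ := logDeriv_riemannXi_eq hre hζ₁
  have hΓ := Literature.NumberTheory.LFunctions.logDeriv_Gammaℝ (critPt_div_two_ne_neg_nat t)
  have hz := logDeriv_riemannZeta_eq hs1 hζ
  have hlog : (Complex.log (π : ℂ)).im = 0 := by
    rw [← Complex.ofReal_log Real.pi_pos.le]; simp
  have key : deriv riemannZeta s / riemannZeta s =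
      logDeriv riemannXi s - 1 / s - (s - 1)⁻¹ + Complex.log π / 2 - Complex.digamma (s / 2) / 2 := by
    rw [← logDeriv_apply, hz, hξ, hΓ]; ring
  rw [key]
  simp only [Complex.sub_im, Complex.add_im]
  rw [im_one_div_critPt, im_inv_critPt_sub_one, Complex.div_ofNat_im, hlog, critPt_div_two,
    Complex.div_ofNat_im]
  ring

/-! ## §3. Under RH: `−Im ξ'/ξ(½+it) = Σₙ [1/(t−γₙ) + 1/(t+γₙ)]` (Ivić (2.1) on the line) -/

/-- `Im (1/(x i)) = −1/x` for real `x` (both sides `0` at `x = 0`). [folklore] -/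
private theorem im_one_div_ofReal_mul_I (x : ℝ) : (1 / ((x : ℂ) * I)).im = -(1 / x) := by
  rcases eq_or_ne x 0 with rfl | hx
  · simp
  · have hI : (x : ℂ) * I ≠ 0 := mul_ne_zero (ofReal_ne_zero.2 hx) I_ne_zero
    have e : 1 / ((x : ℂ) * I) = -((1 / x : ℝ) : ℂ) * I := by
      field_simp
      push_cast
      ring_nf
      rw [I_sq]
      ring
    rw [e]
    simp

variable {b : ℕ → ℂ}

/-- **RH puts the Hadamard zeros on the line**: `Re ρₙ = ½` for every genuine factor (`bₙ ≠ 0`;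
`ρₙ` is a nontrivial zero of `ζ`, `IsHadamardSeq.riemannZeta_xiZero`). [folklore] -/
private theorem re_xiZero_eq_half (hRH : RiemannHypothesis) (h : IsHadamardSeq 0 b) {n : ℕ}
    (hn : b n ≠ 0) : (IsHadamardSeq.xiZero b n).re = 1 / 2 := by
  obtain ⟨hζ, h0, h1⟩ := h.riemannZeta_xiZero hn
  refine hRH _ hζ ?_ ?_
  · rintro ⟨m, hm⟩
    have := congrArg Complex.re hm
    simp at this
    rw [this] at h0
    linarith [m.cast_nonneg (α := ℝ)]
  · intro h1'
    rw [h1'] at h1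
    simp at h1

/-- Under RH, `ρₙ = ½ + iγₙ` with `γₙ = Im ρₙ`. [folklore] -/
private theorem xiZero_eq (hRH : RiemannHypothesis) (h : IsHadamardSeq 0 b) {n : ℕ} (hn : b n ≠ 0) :
    IsHadamardSeq.xiZero b n = 1 / 2 + ((IsHadamardSeq.xiZero b n).im : ℂ) * I := by
  apply Complex.ext
  · simp [re_xiZero_eq_half hRH h hn]
  · simp

/-- The `n`-th pair term of `ξ'/ξ` at `s = ½ + it` under RH:
`−Im [1/(s−ρₙ) + 1/(s−(1−ρₙ))] = 1/(t−γₙ) + 1/(t+γₙ)` (`s − ρₙ = i(t−γₙ)`,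
`s − (1−ρₙ) = i(t+γₙ)`). [cite: Ivic2003, §2, proof of Prop. 1 ((2.1) with ρ = ½ + iγ)] -/
theorem neg_im_pairTerm (hRH : RiemannHypothesis) (h : IsHadamardSeq 0 b) (n : ℕ) (t : ℝ) :
    -(if b n = 0 then (0 : ℂ) else
        1 / ((1 / 2 : ℂ) + (t : ℂ) * I - IsHadamardSeq.xiZero b n) +
          1 / ((1 / 2 : ℂ) + (t : ℂ) * I - (1 - IsHadamardSeq.xiZero b n))).im =
      if b n = 0 then (0 : ℝ) else
        1 / (t - (IsHadamardSeq.xiZero b n).im) + 1 / (t + (IsHadamardSeq.xiZero b n).im) := by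
  split_ifs with hn
  · simp
  · set γ : ℝ := (IsHadamardSeq.xiZero b n).im with hγ
    have hρ := xiZero_eq hRH h hn
    rw [← hγ] at hρ
    have e1 : (1 / 2 : ℂ) + (t : ℂ) * I - IsHadamardSeq.xiZero b n = ((t - γ : ℝ) : ℂ) * I := by
      rw [hρ]; push_cast; ring
    have e2 : (1 / 2 : ℂ) + (t : ℂ) * I - (1 - IsHadamardSeq.xiZero b n) =
        ((t + γ : ℝ) : ℂ) * I := by
      rw [hρ]; push_cast; ring
    rw [e1, e2, Complex.add_im, im_one_div_ofReal_mul_I, im_one_div_ofReal_mul_I]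
    ring

/-- **Ivić (2.1) on the critical line, under RH.** For a Hadamard sequence `b` of `ξ` and
`s = ½ + it` with `ξ(s) ≠ 0`: the real series `Σₙ [1/(t−γₙ) + 1/(t+γₙ)]` (padding indices read
`0`) is summable and sums to `−Im ξ'/ξ(s)` (`= i ξ'/ξ(½+it)`, real).
[cite: Ivic2003, §2 (2.1) (with ρ = ½ + iγ, s = ½ + it)] -/
theorem hasSum_neg_im_logDeriv_riemannXi (hRH : RiemannHypothesis) (h : IsHadamardSeq 0 b) {t : ℝ}
    (hξ : riemannXi ((1 / 2 : ℂ) + (t : ℂ) * I) ≠ 0) :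
    HasSum (fun n ↦ if b n = 0 then (0 : ℝ) else
        1 / (t - (IsHadamardSeq.xiZero b n).im) + 1 / (t + (IsHadamardSeq.xiZero b n).im))
      (-(logDeriv riemannXi ((1 / 2 : ℂ) + (t : ℂ) * I)).im) := by
  have hsum := h.summable_pairs hξ
  have hS := (Complex.hasSum_im hsum.hasSum).neg
  rw [← h.logDeriv_riemannXi_eq_tsum_pairs hξ] at hS
  refine hS.congr_fun fun n ↦ ?_
  exact (neg_im_pairTerm hRH h n t).symm

/-- **Every zero of `ξ` is one of the `ρₙ`, `1 − ρₙ`** (it kills a factor of the Hadamard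
product: `IsHadamardSeq.mult_pos`). [cite: Polymath2019, §3] -/
theorem exists_index_of_riemannXi_eq_zero (h : IsHadamardSeq 0 b) {ρ : ℂ} (hρ : riemannXi ρ = 0) :
    ∃ n, b n ≠ 0 ∧ (ρ = IsHadamardSeq.xiZero b n ∨ ρ = 1 - IsHadamardSeq.xiZero b n) := by
  have hH : deBruijnH 0 (xiToH ρ) = 0 := by
    have := riemannXi_eq_deBruijnH ρ
    rw [hρ] at this
    exact (mul_eq_zero.1 this.symm).resolve_left (by norm_num)
  have hm := h.mult_pos hH
  obtain ⟨n, hn⟩ := Finset.card_pos.1 hm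
  rw [h.mem_zeroIndices, xiToH_sq] at hn
  have hn' : 1 - b n * (2 * ρ - 1) ^ 2 = 0 := by linear_combination hn
  have hb : b n ≠ 0 := by
    intro h0; rw [h0] at hn'; norm_num at hn'
  refine ⟨n, hb, ?_⟩
  rw [IsHadamardSeq.factor_eq_mul b hb] at hn'
  have hprod := (mul_eq_zero.1 hn').resolve_left (mul_ne_zero (by norm_num) hb)
  rcases mul_eq_zero.1 hprod with h1 | h1
  · exact Or.inl (sub_eq_zero.1 h1)
  · exact Or.inr (sub_eq_zero.1 h1)

/-! ## §4. One zero term is strictly decreasing off its pole -/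

/-- `1/(t₁−γ) − 1/(t₂−γ) = (t₂−t₁)/((t₁−γ)(t₂−γ))` when `(t₁−γ)(t₂−γ) ≠ 0`. [folklore] -/
private theorem one_div_sub_one_div_eq {t₁ t₂ γ : ℝ} (h : (t₁ - γ) * (t₂ - γ) ≠ 0) :
    1 / (t₁ - γ) - 1 / (t₂ - γ) = (t₂ - t₁) / ((t₁ - γ) * (t₂ - γ)) := by
  have h1 : t₁ - γ ≠ 0 := fun e ↦ h (by rw [e, zero_mul])
  have h2 : t₂ - γ ≠ 0 := fun e ↦ h (by rw [e, mul_zero])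
  field_simp
  ring

/-- For `t₁ ≤ t₂` on the same side of `γ`: `1/(t₁−γ) − 1/(t₂−γ) ≥ 0`. [folklore] -/
private theorem one_div_sub_one_div_nonneg {t₁ t₂ γ : ℝ} (h : 0 < (t₁ - γ) * (t₂ - γ))
    (h12 : t₁ ≤ t₂) : 0 ≤ 1 / (t₁ - γ) - 1 / (t₂ - γ) := by
  rw [one_div_sub_one_div_eq h.ne']
  exact div_nonneg (by linarith) h.le

/-- If `(t₁ − γ)(t₂ − γ) ≤ 0` and `t₁ ≤ t₂` then `γ ∈ [t₁, t₂]`. [folklore] -/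
private theorem mem_Icc_of_mul_nonpos {t₁ t₂ γ : ℝ} (h : (t₁ - γ) * (t₂ - γ) ≤ 0) (h12 : t₁ ≤ t₂) :
    γ ∈ Icc t₁ t₂ := by
  rcases mul_nonpos_iff.1 h with ⟨h1, h2⟩ | ⟨h1, h2⟩
  · constructor <;> nlinarith
  · constructor <;> linarith

/-! ## §5. A zero of `Z` in every window `(t, t + C₀]` (Riemann–von Mangoldt + RH) -/

/-- **Bounded windows contain critical zeros (under RH).** There are `C₀ > 0` and `T₀` such that
for every `t ≥ T₀` some `γ ∈ (t, t + C₀]` has `ζ(½ + iγ) = 0`. (Unconditionally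
`N(t) < N(t + C₀)` for large `t`, the tree's `SelbergFujii.exists_zetaZeroCount_lt_add` from the
Riemann–von Mangoldt formula; RH puts the new zero on the line. Ivić uses instead Littlewood's
`γ_{n+1} − γ_n ≪ 1/log log γ_n`, (1.12); any bounded gap suffices here.)
[cite: Ivic2003, §2, proof of Prop. 1 (use of (1.12))] -/
theorem exists_critical_zero_window (hRH : RiemannHypothesis) :
    ∃ C₀ : ℝ, 0 < C₀ ∧ ∃ T₀ : ℝ, ∀ t : ℝ, T₀ ≤ t →
      ∃ γ : ℝ, t < γ ∧ γ ≤ t + C₀ ∧ riemannZeta (1 / 2 + (γ : ℂ) * I) = 0 := by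
  obtain ⟨C₀, hC₀, T₀, hN⟩ := SelbergFujii.exists_zetaZeroCount_lt_add
  refine ⟨C₀, hC₀, T₀, fun t ht ↦ ?_⟩
  have hlt := hN t ht
  have hsum := Montgomery.zetaZeroCount_sub_eq_finsum (show t ≤ t + C₀ by linarith)
  have hpos : (0 : ℤ) < ∑ᶠ ρ ∈ zetaZeroBox 0 (t + C₀) \ zetaZeroBox 0 t, riemannZetaZeroOrder ρ := by
    rw [← hsum]
    have : (zetaZeroCount t : ℤ) < zetaZeroCount (t + C₀) := by exact_mod_cast hlt
    linarith
  have hne : (zetaZeroBox 0 (t + C₀) \ zetaZeroBox 0 t).Nonempty := by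
    by_contra h0
    rw [Set.not_nonempty_iff_eq_empty] at h0
    rw [h0, finsum_mem_empty] at hpos
    exact lt_irrefl _ hpos
  obtain ⟨ρ, ⟨hζ, h0, h1, him, hle⟩, hnot⟩ := hne
  have hgt : t < ρ.im := by
    by_contra hle'
    exact hnot ⟨hζ, h0, h1, him, not_lt.1 hle'⟩
  have hre : ρ.re = 1 / 2 := by
    refine hRH ρ hζ ?_ ?_
    · rintro ⟨m, hm⟩
      have := congrArg Complex.im hm
      simp at this
      linarith
    · intro h1'
      rw [h1'] at him
      simp at him
  refine ⟨ρ.im, hgt, hle, ?_⟩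
  have e : (1 / 2 : ℂ) + (ρ.im : ℂ) * I = ρ := by
    apply Complex.ext <;> simp [hre]
  rw [e]; exact hζ

/-! ## §6. The smooth correction grows at rate `O(1/t)` (Ivić: `(f'/f)' ≪ 1/t`) -/

/-- `‖¼ + iy + k‖² = (¼ + k)² + y²`. [folklore] -/
private theorem norm_sq_quarter_add (y : ℝ) (k : ℕ) :
    ‖(1 / 4 : ℂ) + (y : ℂ) * I + (k : ℂ)‖ ^ 2 = (1 / 4 + k) ^ 2 + y ^ 2 := by
  rw [← Complex.normSq_eq_norm_sq, Complex.normSq_apply]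
  simp
  ring

/-- The series `Σₖ 1/‖w + k‖²` (`w = ¼ + iy`, `y ≠ 0`) is summable. [folklore] -/
private theorem summable_inv_norm_sq {y : ℝ} (hy : y ≠ 0) :
    Summable fun k : ℕ ↦ 1 / ‖(1 / 4 : ℂ) + (y : ℂ) * I + (k : ℂ)‖ ^ 2 := by
  have h := (Literature.Analysis.SpecialFunctions.Complex.hasSum_im_digamma
    (w := (1 / 4 : ℂ) + (y : ℂ) * I) (by simp)).summable.mul_left (1 / y)
  refine h.congr fun k ↦ ?_
  have hy' : ((1 / 4 : ℂ) + (y : ℂ) * I).im = y := by simp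
  rw [hy']
  field_simp

/-- **Increment of `Im ψ(¼ + iy)`**: for `0 < y₁ ≤ y₂`,
`Im ψ(¼ + iy₂) − Im ψ(¼ + iy₁) ≤ (y₂ − y₁)(1/‖¼ + iy₁‖² + π/(2y₁))`
(termwise in `Im ψ(w) = Σₖ Im w/‖w + k‖²`, then the tree's `tsum_inv_norm_add_sq_le`).
[cite: Ivic2003, §2, proof of Prop. 1 (Stirling step, `(f'/f)' ≪ 1/t`)] -/
theorem im_digamma_sub_le {y₁ y₂ : ℝ} (hy₁ : 0 < y₁) (h12 : y₁ ≤ y₂) :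
    (Complex.digamma ((1 / 4 : ℂ) + (y₂ : ℂ) * I)).im -
        (Complex.digamma ((1 / 4 : ℂ) + (y₁ : ℂ) * I)).im ≤
      (y₂ - y₁) * (1 / ‖(1 / 4 : ℂ) + (y₁ : ℂ) * I‖ ^ 2 + π / (2 * y₁)) := by
  set w₁ : ℂ := (1 / 4 : ℂ) + (y₁ : ℂ) * I with hw₁
  set w₂ : ℂ := (1 / 4 : ℂ) + (y₂ : ℂ) * I with hw₂
  have hy₂ : 0 < y₂ := lt_of_lt_of_le hy₁ h12
  have h1 := Literature.Analysis.SpecialFunctions.Complex.hasSum_im_digamma (w := w₁) (by simp [hw₁])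
  have h2 := Literature.Analysis.SpecialFunctions.Complex.hasSum_im_digamma (w := w₂) (by simp [hw₂])
  have him₁ : w₁.im = y₁ := by simp [hw₁]
  have him₂ : w₂.im = y₂ := by simp [hw₂]
  rw [him₁] at h1
  rw [him₂] at h2
  have hS := summable_inv_norm_sq hy₁.ne'
  -- termwise comparison `y₂/‖w₂+k‖² ≤ y₂/‖w₁+k‖²`
  have hle : ∑' k : ℕ, y₂ / ‖w₂ + k‖ ^ 2 ≤ ∑' k : ℕ, y₂ * (1 / ‖w₁ + k‖ ^ 2) := by
    refine Summable.tsum_le_tsum (fun k ↦ ?_) h2.summable (hS.mul_left y₂)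
    rw [← div_eq_mul_one_div]
    have hD₁ : 0 < ‖w₁ + k‖ ^ 2 := by
      rw [hw₁, norm_sq_quarter_add]; positivity
    apply div_le_div_of_nonneg_left hy₂.le hD₁
    rw [hw₁, hw₂, norm_sq_quarter_add, norm_sq_quarter_add]
    nlinarith
  rw [← h2.tsum_eq, ← h1.tsum_eq]
  have e1 : ∑' k : ℕ, y₁ / ‖w₁ + k‖ ^ 2 = y₁ * ∑' k : ℕ, 1 / ‖w₁ + k‖ ^ 2 := by
    rw [← tsum_mul_left]; exact tsum_congr fun k ↦ by ring
  rw [tsum_mul_left] at hle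
  rw [e1]
  have hT := Literature.Analysis.SpecialFunctions.Complex.tsum_inv_norm_add_sq_le (w := w₁)
    (by simp [hw₁]) (by simp [hw₁, hy₁.ne'])
  rw [him₁, abs_of_pos hy₁] at hT
  have hT0 : 0 ≤ ∑' k : ℕ, 1 / ‖w₁ + k‖ ^ 2 := tsum_nonneg fun _ ↦ by positivity
  nlinarith [mul_le_mul_of_nonneg_left hT (sub_nonneg.2 h12)]

/-- `‖¼ + iy‖² = 1/16 + y²`. [folklore] -/
private theorem norm_sq_quarter (y : ℝ) : ‖(1 / 4 : ℂ) + (y : ℂ) * I‖ ^ 2 = 1 / 16 + y ^ 2 := by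
  rw [← Complex.normSq_eq_norm_sq, Complex.normSq_apply]
  simp
  ring

/-- The rational part: `2t₁/(t₁²+¼) − 2t₂/(t₂²+¼) ≤ 2(t₂−t₁)/t₁` for `1 ≤ t₁ ≤ t₂`. [folklore] -/
private theorem rational_sub_le {t₁ t₂ : ℝ} (h1 : 1 ≤ t₁) (h12 : t₁ ≤ t₂) :
    2 * t₁ / (t₁ ^ 2 + 1 / 4) - 2 * t₂ / (t₂ ^ 2 + 1 / 4) ≤ 2 * (t₂ - t₁) / t₁ := by
  have key : 2 * t₁ / (t₁ ^ 2 + 1 / 4) - 2 * t₂ / (t₂ ^ 2 + 1 / 4) =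
      2 * (t₂ - t₁) * (t₁ * t₂ - 1 / 4) / ((t₁ ^ 2 + 1 / 4) * (t₂ ^ 2 + 1 / 4)) := by
    field_simp
    ring
  rw [key, div_le_div_iff₀ (by positivity) (by positivity)]
  have h0 : 0 ≤ 2 * (t₂ - t₁) := by linarith
  have h3 : (t₁ * t₂ - 1 / 4) * t₁ ≤ (t₁ ^ 2 + 1 / 4) * (t₂ ^ 2 + 1 / 4) := by
    nlinarith [mul_nonneg (sub_nonneg.2 h1) (sub_nonneg.2 (h1.trans h12)),
      mul_nonneg (mul_nonneg (by linarith : (0 : ℝ) ≤ t₁) (by linarith : (0 : ℝ) ≤ t₁))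
        (sub_nonneg.2 (h1.trans h12))]
  calc 2 * (t₂ - t₁) * (t₁ * t₂ - 1 / 4) * t₁ = 2 * (t₂ - t₁) * ((t₁ * t₂ - 1 / 4) * t₁) := by ring
    _ ≤ 2 * (t₂ - t₁) * ((t₁ ^ 2 + 1 / 4) * (t₂ ^ 2 + 1 / 4)) :=
        mul_le_mul_of_nonneg_left h3 h0

/-- **The correction `c(t) = −2t/(t²+¼) + ½ Im ψ(¼ + it/2)` has increments `≤ 4(t₂−t₁)/t₁`**
(`1 ≤ t₁ ≤ t₂`); Ivić: `(f'/f)' ≪ 1/t` by Stirling's formula — here by the exact series for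
`Im ψ`. [cite: Ivic2003, §2, proof of Prop. 1 (`d/dt (f'/f) ≪ 1/t`)] -/
theorem corr_sub_le {t₁ t₂ : ℝ} (h1 : 1 ≤ t₁) (h12 : t₁ ≤ t₂) :
    (-(2 * t₂ / (t₂ ^ 2 + 1 / 4)) + (Complex.digamma ((1 / 4 : ℂ) + ((t₂ / 2 : ℝ) : ℂ) * I)).im / 2) -
        (-(2 * t₁ / (t₁ ^ 2 + 1 / 4)) + (Complex.digamma ((1 / 4 : ℂ) + ((t₁ / 2 : ℝ) : ℂ) * I)).im / 2)
      ≤ 4 * (t₂ - t₁) / t₁ := by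
  have hr := rational_sub_le h1 h12
  have hy₁ : (0 : ℝ) < t₁ / 2 := by linarith
  have hd := im_digamma_sub_le hy₁ (by linarith : t₁ / 2 ≤ t₂ / 2)
  have hn : ‖(1 / 4 : ℂ) + ((t₁ / 2 : ℝ) : ℂ) * I‖ ^ 2 = 1 / 16 + (t₁ / 2) ^ 2 := norm_sq_quarter _
  rw [hn] at hd
  have hπ : π < 4 := Real.pi_lt_four
  have ht₁ : 0 < t₁ := by linarith
  -- `1/(1/16 + t₁²/4) ≤ 4/t₁²` and `π/(2 (t₁/2)) ≤ 4/t₁`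
  have hA : 1 / (1 / 16 + (t₁ / 2) ^ 2) ≤ 4 / t₁ ^ 2 := by
    rw [div_le_div_iff₀ (by positivity) (by positivity)]; nlinarith
  have hB : π / (2 * (t₁ / 2)) ≤ 4 / t₁ := by
    rw [show 2 * (t₁ / 2) = t₁ by ring]
    exact div_le_div_of_nonneg_right hπ.le ht₁.le
  have hC : 4 / t₁ ^ 2 ≤ 4 / t₁ := by
    apply div_le_div_of_nonneg_left (by norm_num) ht₁; nlinarith
  have hsum : (t₂ / 2 - t₁ / 2) * (1 / (1 / 16 + (t₁ / 2) ^ 2) + π / (2 * (t₁ / 2))) ≤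
      (t₂ / 2 - t₁ / 2) * (4 / t₁ + 4 / t₁) :=
    mul_le_mul_of_nonneg_left (by linarith) (by linarith)
  have e : (t₂ / 2 - t₁ / 2) * (4 / t₁ + 4 / t₁) / 2 = 2 * (t₂ - t₁) / t₁ := by
    field_simp; ring
  have e2 : 2 * (t₂ - t₁) / t₁ + 2 * (t₂ - t₁) / t₁ = 4 * (t₂ - t₁) / t₁ := by ring
  linarith

/-! ## §7. Assembly -/

/-- `ξ(½ + it) ≠ 0` where `ζ(½ + it) ≠ 0`. [folklore] -/
private theorem riemannXi_critPt_ne_zero {t : ℝ} (hζ : riemannZeta (1 / 2 + (t : ℂ) * I) ≠ 0) :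
    riemannXi ((1 / 2 : ℂ) + (t : ℂ) * I) ≠ 0 := fun h ↦
  hζ ((riemannXi_eq_zero_iff_holds _).1 h).1

/-- A critical zero `ζ(½ + iγ) = 0` is a zero of `ξ`. [folklore] -/
private theorem riemannXi_critPt_eq_zero {γ : ℝ} (hζ : riemannZeta (1 / 2 + (γ : ℂ) * I) = 0) :
    riemannXi ((1 / 2 : ℂ) + (γ : ℂ) * I) = 0 :=
  (riemannXi_eq_zero_iff_holds _).2 ⟨hζ, by simp, by norm_num⟩

/-- Under RH the zero `ρₙ` (`bₙ ≠ 0`) gives zeros of `Z` at `±γₙ`: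
`ζ(½ + iγₙ) = 0` and `ζ(½ − iγₙ) = 0`. [folklore] -/
private theorem zeta_critPt_xiZero_eq_zero (hRH : RiemannHypothesis) (h : IsHadamardSeq 0 b) {n : ℕ}
    (hn : b n ≠ 0) :
    riemannZeta (1 / 2 + ((IsHadamardSeq.xiZero b n).im : ℂ) * I) = 0 ∧
      riemannZeta (1 / 2 + ((-(IsHadamardSeq.xiZero b n).im : ℝ) : ℂ) * I) = 0 := by
  have hρ := xiZero_eq hRH h hn
  have hζ := (h.riemannZeta_xiZero hn).1
  rw [hρ] at hζ
  refine ⟨hζ, ?_⟩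
  have hc : (starRingEnd ℂ) ((1 / 2 : ℂ) + ((IsHadamardSeq.xiZero b n).im : ℂ) * I) =
      1 / 2 + ((-(IsHadamardSeq.xiZero b n).im : ℝ) : ℂ) * I := by
    apply Complex.ext <;> simp
  rw [← hc, riemannZeta_conj, hζ, map_zero]

/-- **The zero sum strictly decreases across a zero-free interval, by at least `(t₂−t₁)/C₀²`**
when a critical zero `γ` lies within `C₀` to the right of `t₁`: every term
`1/(t−γₙ) + 1/(t+γₙ)` decreases (its poles `±γₙ` are zeros of `Z`, hence outside `[t₁, t₂]`),
and the term of `γ` alone loses `(t₂−t₁)/((γ−t₁)(γ−t₂)) ≥ (t₂−t₁)/C₀²`.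
[cite: Ivic2003, §2, proof of Prop. 1 (`−Σ_γ (t−γ)^{−2} < −C (log log t)²`)] -/
theorem tsum_decrement (hRH : RiemannHypothesis) (h : IsHadamardSeq 0 b)
    {a a' t₁ t₂ γ C₀ : ℝ} (ha : 0 ≤ a) (hfree : ∀ t ∈ Ioo a a', hardyZ t ≠ 0)
    (ht₁ : t₁ ∈ Ioo a a') (ht₂ : t₂ ∈ Ioo a a') (hlt : t₁ < t₂)
    (hγζ : riemannZeta (1 / 2 + (γ : ℂ) * I) = 0) (hγ₁ : t₁ < γ) (hγC : γ ≤ t₁ + C₀) :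
    (t₂ - t₁) / C₀ ^ 2 ≤
      (∑' n, if b n = 0 then (0 : ℝ) else
          1 / (t₁ - (IsHadamardSeq.xiZero b n).im) + 1 / (t₁ + (IsHadamardSeq.xiZero b n).im)) -
        ∑' n, if b n = 0 then (0 : ℝ) else
          1 / (t₂ - (IsHadamardSeq.xiZero b n).im) + 1 / (t₂ + (IsHadamardSeq.xiZero b n).im) := by
  have hZ : ∀ t ∈ Ioo a a', riemannZeta (1 / 2 + (t : ℂ) * I) ≠ 0 := fun t ht h0 ↦
    hfree t ht ((hardyZ_eq_zero_iff_holds t).2 h0)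
  -- the nearby zero lies beyond the interval
  have hγa' : a' ≤ γ := by
    by_contra hlt'
    exact hZ γ ⟨ht₁.1.trans hγ₁, not_le.1 hlt'⟩ hγζ
  have hγ₂ : t₂ < γ := ht₂.2.trans_le hγa'
  have hsum₁ := (hasSum_neg_im_logDeriv_riemannXi hRH h (riemannXi_critPt_ne_zero (hZ t₁ ht₁))).summable
  have hsum₂ := (hasSum_neg_im_logDeriv_riemannXi hRH h (riemannXi_critPt_ne_zero (hZ t₂ ht₂))).summable
  rw [← hsum₁.tsum_sub hsum₂]
  -- no pole `±γₙ` inside `[t₁, t₂]`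
  have hpole : ∀ n, b n ≠ 0 →
      0 < (t₁ - (IsHadamardSeq.xiZero b n).im) * (t₂ - (IsHadamardSeq.xiZero b n).im) ∧
        0 < (t₁ - -(IsHadamardSeq.xiZero b n).im) * (t₂ - -(IsHadamardSeq.xiZero b n).im) := by
    intro n hn
    obtain ⟨hz₁, hz₂⟩ := zeta_critPt_xiZero_eq_zero hRH h hn
    constructor
    · by_contra hle
      obtain ⟨hl, hr⟩ := mem_Icc_of_mul_nonpos (not_lt.1 hle) hlt.le
      exact hZ _ ⟨ht₁.1.trans_le hl, hr.trans_lt ht₂.2⟩ hz₁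
    · by_contra hle
      obtain ⟨hl, hr⟩ := mem_Icc_of_mul_nonpos (not_lt.1 hle) hlt.le
      refine hZ _ ⟨ht₁.1.trans_le hl, hr.trans_lt ht₂.2⟩ ?_
      exact_mod_cast hz₂
  -- every term decreases
  have hnonneg : ∀ n, 0 ≤ (if b n = 0 then (0 : ℝ) else
      1 / (t₁ - (IsHadamardSeq.xiZero b n).im) + 1 / (t₁ + (IsHadamardSeq.xiZero b n).im)) -
      (if b n = 0 then (0 : ℝ) else
      1 / (t₂ - (IsHadamardSeq.xiZero b n).im) + 1 / (t₂ + (IsHadamardSeq.xiZero b n).im)) := by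
    intro n
    split_ifs with hn
    · simp
    · obtain ⟨p1, p2⟩ := hpole n hn
      have e : ∀ t : ℝ, t + (IsHadamardSeq.xiZero b n).im = t - -(IsHadamardSeq.xiZero b n).im :=
        fun t ↦ by ring
      rw [e t₁, e t₂]
      have h1 := one_div_sub_one_div_nonneg p1 hlt.le
      have h2 := one_div_sub_one_div_nonneg p2 hlt.le
      linarith
  -- the index of the nearby zero
  obtain ⟨n₀, hn₀, hcases⟩ := exists_index_of_riemannXi_eq_zero h (riemannXi_critPt_eq_zero hγζ)
  have hγn : (IsHadamardSeq.xiZero b n₀).im = γ ∨ (IsHadamardSeq.xiZero b n₀).im = -γ := by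
    rcases hcases with hc | hc
    · left; rw [← hc]; simp
    · right
      have : IsHadamardSeq.xiZero b n₀ = 1 - (1 / 2 + (γ : ℂ) * I) := by rw [hc]; ring
      rw [this]; simp
  have hC₀ : (t₁ - γ) * (t₂ - γ) ≤ C₀ ^ 2 := by
    have e : (t₁ - γ) * (t₂ - γ) = (γ - t₁) * (γ - t₂) := by ring
    rw [e, sq]
    exact mul_le_mul (by linarith) (by linarith) (by linarith) (by linarith)
  have hmain : (t₂ - t₁) / C₀ ^ 2 ≤ 1 / (t₁ - γ) - 1 / (t₂ - γ) := by
    have hp : 0 < (t₁ - γ) * (t₂ - γ) := by nlinarith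
    rw [one_div_sub_one_div_eq hp.ne']
    exact div_le_div_of_nonneg_left (by linarith) hp hC₀
  have hplus : 0 ≤ 1 / (t₁ + γ) - 1 / (t₂ + γ) := by
    have e : ∀ t : ℝ, t + γ = t - -γ := fun t ↦ by ring
    rw [e t₁, e t₂]
    refine one_div_sub_one_div_nonneg ?_ hlt.le
    have : 0 < t₁ := ha.trans_lt ht₁.1
    nlinarith
  have hterm : (t₂ - t₁) / C₀ ^ 2 ≤ (if b n₀ = 0 then (0 : ℝ) else
      1 / (t₁ - (IsHadamardSeq.xiZero b n₀).im) + 1 / (t₁ + (IsHadamardSeq.xiZero b n₀).im)) -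
      (if b n₀ = 0 then (0 : ℝ) else
      1 / (t₂ - (IsHadamardSeq.xiZero b n₀).im) + 1 / (t₂ + (IsHadamardSeq.xiZero b n₀).im)) := by
    rw [if_neg hn₀, if_neg hn₀]
    rcases hγn with hg | hg <;> rw [hg]
    · linarith
    · have e1 : ∀ t : ℝ, t - -γ = t + γ := fun t ↦ by ring
      have e2 : ∀ t : ℝ, t + -γ = t - γ := fun t ↦ by ring
      simp only [e1, e2]
      linarith
  exact hterm.trans ((hsum₁.sub hsum₂).le_tsum n₀ fun j _ ↦ hnonneg j)

end Ivic2003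

open Ivic2003 in
/-- **Ivić 2003, Proposition 1 — PROVED.** Under the Riemann hypothesis there is `t₀` such that
`Z'/Z` is strictly decreasing on every zero-free interval `(a, b)` of Hardy's `Z` with `a ≥ t₀`.
Proof (Ivić, arXiv:math/0311162 §2, with the deviations recorded in the module docstring):
`Z'/Z(t) = Σₙ [1/(t−γₙ)+1/(t+γₙ)] − 2t/(t²+¼) + ½ Im ψ(¼+it/2)` under RH; on a zero-free
`(a,b)` every zero term decreases, the term of a zero `γ ∈ (t₁, t₁ + C₀]` (Riemann–von Mangoldt)
drops by `≥ (t₂−t₁)/C₀²`, while the smooth part rises by `≤ 4(t₂−t₁)/t₁ < (t₂−t₁)/C₀²` once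
`t₁ > 4C₀²`. Discharges `Literature.NumberTheory.LFunctions.Ivic2003_prop1`.
[cite: Ivic2003, §2 Proposition 1 (BorweinChoiRooneyWeirathmueller2008 pp. 112–113)] -/
theorem Ivic2003_prop1_holds : Ivic2003_prop1 := by
  intro hRH
  obtain ⟨d, hd⟩ := exists_isHadamardSeq 0
  obtain ⟨C₀, hC₀, T₀, hwin⟩ := exists_critical_zero_window hRH
  refine ⟨max (max T₀ 1) (4 * C₀ ^ 2 + 1), fun a a' ha hfree ↦ ?_⟩
  have haT : T₀ ≤ a := ((le_max_left _ _).trans (le_max_left _ _)).trans ha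
  have ha1 : 1 ≤ a := ((le_max_right _ _).trans (le_max_left _ _)).trans ha
  have haC : 4 * C₀ ^ 2 + 1 ≤ a := (le_max_right _ _).trans ha
  intro t₁ ht₁ t₂ ht₂ hlt
  have hZ : ∀ t ∈ Ioo a a', riemannZeta (1 / 2 + (t : ℂ) * I) ≠ 0 := fun t ht h0 ↦
    hfree t ht ((hardyZ_eq_zero_iff_holds t).2 h0)
  -- the formula for `Z'/Z` on the interval
  have hform : ∀ t ∈ Ioo a a', deriv hardyZ t / hardyZ t =
      (∑' n, if d n = 0 then (0 : ℝ) else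
          1 / (t - (IsHadamardSeq.xiZero d n).im) + 1 / (t + (IsHadamardSeq.xiZero d n).im)) +
        (-(2 * t / (t ^ 2 + 1 / 4)) +
          (Complex.digamma ((1 / 4 : ℂ) + ((t / 2 : ℝ) : ℂ) * I)).im / 2) := by
    intro t ht
    rw [deriv_hardyZ_div_eq (hZ t ht), neg_im_logDeriv_zeta_critPt (hZ t ht),
      ← (hasSum_neg_im_logDeriv_riemannXi hRH hd (riemannXi_critPt_ne_zero (hZ t ht))).tsum_eq]
    ring
  show deriv hardyZ t₂ / hardyZ t₂ < deriv hardyZ t₁ / hardyZ t₁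
  rw [hform t₁ ht₁, hform t₂ ht₂]
  obtain ⟨γ, hγ1, hγ2, hγζ⟩ := hwin t₁ (by linarith [ht₁.1])
  have hS := tsum_decrement hRH hd (by linarith) hfree ht₁ ht₂ hlt hγζ hγ1 hγ2
  have hc := corr_sub_le (by linarith [ht₁.1] : (1 : ℝ) ≤ t₁) hlt.le
  have ht₁C : 4 * C₀ ^ 2 < t₁ := by linarith [ht₁.1]
  have ht₁0 : 0 < t₁ := by linarith [ht₁.1]
  have hgap : 4 * (t₂ - t₁) / t₁ < (t₂ - t₁) / C₀ ^ 2 := by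
    rw [div_lt_div_iff₀ ht₁0 (by positivity)]
    nlinarith [mul_lt_mul_of_pos_left ht₁C (sub_pos.2 hlt)]
  linarith

end Literature.NumberTheory.LFunctions
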